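import Literature.NumberTheory.EllipticCurves.Sprung2017.SharpFlatPAdicLFunctionProofs
import Literature.NumberTheory.EllipticCurves.PAdicLFunctionIntegralityAtTwoSplitMultProofs
import HarnessLib

/-!
# Sprung's ♯/♭ pair at `p = 2`: the Mazur–Tate characterisation `IsSprungPair f 2 a₂ L♯ L♭` holds
# for every curve with good SUPERSINGULAR reduction at `2` (theorems only)

Topic `NumberTheory/EllipticCurves`; `Proofs` companion (no definition, no named fact) of
`Literature.NumberTheory.EllipticCurves.Sprung2017.SharpFlatPAdicLFunction` /
`…SharpFlatPAdicLFunctionProofs`. The named fact `thm112_exists_isSprungPair` and its proof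
`thm112_exists_isSprungPair_holds` carry the binder `p ≠ 2` ("NOT vendored: … `p = 2`", module
docstring of `SharpFlatPAdicLFunction`), and F. Sprung, Algebra Number Theory 11 (2017) 885–928
(= arXiv:1601.00010) [Sprung2017] treats `p = 2` throughout with the single modification of §1.1:
"we let `N = n + 1` if `p` is odd and `N = n + 2` if `p` is even, so that `Γ_n ≅ ℤ/p^n`"
[corpus: paper:arxiv-1601.00010 p0004–p0007: §1.1 (γ, the shift), Def. 1.7 / Example 1.8 (queue
sequences), Cor. 4.4 (`(Θ_n, νΘ_{n−1}) = Υ_n 𝒞_1⋯𝒞_n Ã⁻¹`), "Proposition (yeah)" `𝔐 = 0` for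
supersingular `p`, proof of Thm. 1.12]. The tree's Mazur–Tate element `mazurTateElement f 2 n`
IS the level-`2^{n+2}` element (`cyclotomicExponent 2 = 2`, `Γ = 1 + 4ℤ₂`, `γ = 5`;
`PlusMinusPAdicLFunction.lean`, "for `p = 2` this is the analogous element at level `2^{n+2}`"),
i.e. Sprung's shift is built into the tree object, and the whole construction of
`exists_integral_isSprungPair` is `p`-uniform EXCEPT its integrality input
(`norm_ratPlusSymbol_le_one`, `‖4‖_p = 1`): at `2` the symbols `[a/2^k]⁺_f` are only
HALF-integral (`norm_ratPlusSymbol_two_le_two`: `[x]⁺ ∈ (2n₀)⁻¹ℤ` with `n₀ = a₂ − 3` the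
Eisenstein number, ODD exactly when `a₂` is even, i.e. at a good supersingular `2`). The missing
factor `2` is supplied by the torsion `Δ = {±1}` of `ℤ₂^×`: the units `±5^s` have the same image
in `Γ`, and `[−r]⁺ = [r]⁺` (`ratPlusSymbol_neg`, from the named-and-proved `modularSymbol_neg_eq_conj`),
so every coefficient of `θ_n` at `2` is `2·[5^s/2^{n+2}]⁺ ∈ ℤ₂` — the "`Δ`-doubling" already used
for the `2`-adic `L`-function of an ORDINARY `2` in `PAdicLFunctionIntegralityAtTwoProofs`
(`padicLRiemannSum_two`). This file proves (o1 lens-1 route R-L1-G6-A "Sprung pair at `2` in the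
tree", cell `b2b-bsdres`, typer item (22); nothing unprinted is used):

* `mazurTateElement_two_eq` — **the `Δ`-doubling of `θ_n` at `2`**:
  `θ_n = ∑_{s mod 2ⁿ} 2·[5^s/2^{n+2}]⁺_f (1+T)^s`;
* `norm_ratPlusSymbol_div_two_pow_le_two_of_even` — `‖[a/2^k]⁺_f‖₂ ≤ 2` for the newform of level
  `N`, `2 ∤ N`, `a₂` even (Eisenstein number `a₂ − 3` odd; `sub_mul_modularSymbol_zero_mem_periodLattice`);
* `exists_map_eq_map_mazurTateElement_two` — **`θ_n ∈ ℤ₂[T]`** at a good supersingular `2`;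
* `exists_integral_isSprungPair_two` — the integral pair at `2`
  (`exists_lifts_threeTerm_of_lifts` + `exists_integral_isSprungPair_of_lifts`, the `p`-uniform
  parts of the odd-`p` file, fed with the lifts above);
* **`exists_isSprungPair_two`** (lens-1's typed target **T2-pair**): `IsNewformOf W f →`
  `W.HasGoodReductionAtPrime 2 → (2 : ℤ) ∣ a₂(W) → ∃ L♯ L♭ : Λ, IsSprungPair f 2 (a₂(W)) L♯ L♭`;
* `exists_isSprungPair_anyPrime` — the prime-uniform statement (odd `p`:
  `thm112_exists_isSprungPair_holds`; `p = 2`: the above).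

What this does NOT say (honest scope): uniqueness at `2` is `IsSprungPair.unique` (needs
`(2 : ℤ) ∣ a₂`, fine for `a₂ ∈ {0, ±2}`); the special values at `T = 0` differ from the odd-`p`
table `chromaticConst` because of the shift (Sprung's table after Cor. 4.11, row `p = 2`); the
functional equation / `λ`-parity at `2` (lens-1 R-L1-G6-B) and anything algebraic (signed Selmer
groups at `2`) are not touched. HONEST FRAMING of the cell (verbatim): prove what is provable now;
shrink each hard class to its core with data; no claim beyond stated classes. Net named-fact debt: 0.

## References

* F. Sprung, Algebra Number Theory 11 (2017) 885–928, §1.1, Def. 1.7, Example 1.8, Thm. 1.12,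
  Cor. 4.4, Cor. 4.5, Cor. 4.10, Cor. 4.11 [Sprung2017] [corpus: paper:arxiv-1601.00010 p0004–p0007,
  p0016–p0017].
* B. Mazur, J. Tate, J. Teitelbaum, Invent. Math. 84 (1986), §I.8 (`[−r]⁺ = [r]⁺`), §I.13
  (`p = 2`: `Δ = {±1}`, `γ = 5`) [MazurTateTeitelbaum1986Invent].
* J. Cremona, *Algorithms for modular elliptic curves* (1997), §2.8 (real periods, `Ω⁺ = 2·`least
  real part) [CremonaAlgorithms1997].
-/

noncomputable section

open scoped MatrixGroups ModularForm

open CongruenceSubgroup Polynomial Literature.NumberTheory.EllipticCurves.ModularForms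
  Literature.NumberTheory.EllipticCurves

namespace Literature.NumberTheory.EllipticCurves.Sprung2017

/-! ## §1. The `Δ = {±1}` doubling of the Mazur–Tate element at `2` -/

section Doubling

variable {N : ℕ} [NeZero N] (f : CuspForm (Gamma0 N) 2)

/-- The `2`-adic roots of unity of order dividing `2` are `±1`; private helper (as in
`PAdicLFunctionIntegralityAtTwoProofs`). [folklore] -/
private theorem coe_rootsOfUnity_two_eq_or' (ξ : rootsOfUnity 2 ℤ_[2]) :
    ((ξ : ℤ_[2]ˣ) : ℤ_[2]) = 1 ∨ ((ξ : ℤ_[2]ˣ) : ℤ_[2]) = -1 := by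
  have h := ξ.2
  rw [mem_rootsOfUnity] at h
  have h' : (((ξ : ℤ_[2]ˣ) : ℤ_[2])) ^ 2 = 1 := by
    rw [← Units.val_pow_eq_pow_val, h, Units.val_one]
  exact sq_eq_one_iff.mp h'

/-- **The `Δ`-doubling of `θ_n` at `p = 2`**: the Mazur–Tate element of level `2^{n+2}` is
`θ_n(T) = ∑_{s mod 2ⁿ} 2·[5^s/2^{n+2}]⁺_f (1+T)^s` — the torsion of `ℤ₂^×` is `{±1}`, the units
`5^s` and `−5^s` restrict to the same element of `Gal(ℚ_n/ℚ)`, and `[(2^{n+2} − v)/2^{n+2}]⁺ =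
[v/2^{n+2}]⁺` (`ratPlusSymbol_neg_val_div`: periodicity and `[−r]⁺ = [r]⁺`).
[cite: MazurTateTeitelbaum1986Invent, §I.13 (p = 2: Δ = {±1}, γ = 5) and §I.8] -/
theorem mazurTateElement_two_eq (n : ℕ) :
    mazurTateElement f 2 n = ∑ s : ZMod (2 ^ n),
      C (2 * ratPlusSymbol f
        ((((cyclotomicGenerator 2 : ZMod (2 ^ (n + 2))) ^ s.val).val : ℚ) / (2 : ℚ) ^ (n + 2))) *
        (X + 1) ^ s.val := by
  classical
  -- the summand as a function of the Teichmüller representative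
  set G : ℤ_[2] → ℚ[X] := fun u ↦ ∑ s : ZMod (2 ^ n),
    C (ratPlusSymbol f
      (((PadicInt.toZModPow (n + 2) u *
          (cyclotomicGenerator 2 : ZMod (2 ^ (n + 2))) ^ s.val).val : ℚ) / (2 : ℚ) ^ (n + 2))) *
      (X + 1) ^ s.val with hG
  have hG1 : G 1 = ∑ s : ZMod (2 ^ n),
      C (ratPlusSymbol f
        ((((cyclotomicGenerator 2 : ZMod (2 ^ (n + 2))) ^ s.val).val : ℚ) / (2 : ℚ) ^ (n + 2))) *
        (X + 1) ^ s.val := by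
    simp only [hG, map_one, one_mul]
  have hGneg : G (-1) = G 1 := by
    simp only [hG, map_neg, map_one, neg_one_mul, one_mul]
    refine Finset.sum_congr rfl fun s _ ↦ ?_
    have h := ratPlusSymbol_neg_val_div f (n + 2)
      ((cyclotomicGenerator 2 : ZMod (2 ^ (n + 2))) ^ s.val)
    push_cast at h ⊢
    rw [h]
  -- the torsion group at `2` is `{1, ζ}` with `ζ = -1`
  have hζmem : (-1 : ℤ_[2]ˣ) ∈ rootsOfUnity 2 ℤ_[2] := by
    rw [mem_rootsOfUnity]; norm_num
  set ζ : rootsOfUnity 2 ℤ_[2] := ⟨-1, hζmem⟩ with hζ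
  have hne : (1 : rootsOfUnity 2 ℤ_[2]) ≠ ζ := by
    intro h
    have h' : (((1 : rootsOfUnity 2 ℤ_[2]) : ℤ_[2]ˣ) : ℤ_[2]) = ((ζ : ℤ_[2]ˣ) : ℤ_[2]) := by
      rw [h]
    rw [hζ] at h'
    simp only [OneMemClass.coe_one, Units.val_one, Units.val_neg] at h'
    have h2 : (2 : ℤ_[2]) = 0 := by linear_combination h'
    exact two_ne_zero h2
  haveI : Fintype (rootsOfUnity 2 ℤ_[2]) := Fintype.ofFinite _
  have huniv : (Finset.univ : Finset (rootsOfUnity 2 ℤ_[2])) = {1, ζ} := by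
    ext ξ
    simp only [Finset.mem_univ, Finset.mem_insert, Finset.mem_singleton, true_iff]
    rcases coe_rootsOfUnity_two_eq_or' ξ with h | h
    · left
      exact Subtype.ext (Units.ext (by simpa using h))
    · right
      exact Subtype.ext (Units.ext (by rw [hζ]; simpa using h))
  -- unfold the Mazur–Tate element at `p = 2` (`cyclotomicExponent 2 = 2` by computation)
  have hθ : mazurTateElement f 2 n =
      ∑ᶠ ξ : rootsOfUnity (torsionOrder 2) ℤ_[2], G ((ξ : ℤ_[2]ˣ) : ℤ_[2]) := by
    rw [mazurTateElement]
    rfl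
  rw [hθ, torsionOrder_two, finsum_eq_sum_of_fintype, huniv, Finset.sum_pair hne]
  simp only [OneMemClass.coe_one, Units.val_one, hζ, Units.val_neg]
  rw [hGneg, hG1, ← Finset.sum_add_distrib]
  refine Finset.sum_congr rfl fun s _ ↦ ?_
  rw [← add_mul, ← map_add, ← two_mul]

end Doubling

/-! ## §2. Half-integrality of the symbols and integrality of `θ_n` at a good supersingular `2` -/

section Integral

variable {N : ℕ} [NeZero N] {f : CuspForm (Gamma0 N) 2}

/-- **`‖[a/2^k]⁺_f‖₂ ≤ 2`** for the newform `f` of odd level `N` with `a₂` EVEN: the Eisenstein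
multiple `(a₂ − 2 − 1)·{∞, 0}_f ∈ Λ_f` (`sub_mul_modularSymbol_zero_mem_periodLattice`, the Hecke
relation at the good prime `2`) has the ODD multiplier `n₀ = a₂ − 3`, so `[x]⁺_f = k/(2n₀)` has
`2`-adic norm `≤ 2` (`norm_ratPlusSymbol_two_le_two`; real coefficients from `coeffField f = ⊥`).
At a good supersingular `2` (`a₂ ∈ {0, ±2}`) this is the whole integrality input — no hypothesis on
`E[2]`, the image or the Manin constant. [cite: CremonaAlgorithms1997, §2.8] -/
theorem norm_ratPlusSymbol_div_two_pow_le_two_of_even (hf0 : IsNewform0 f) (hQ : coeffField f = ⊥)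
    (hN : ¬ 2 ∣ N) {ap : ℤ} (hap : cuspCoeff f 2 = ap) (hpa : (2 : ℤ) ∣ ap) (a k : ℕ) :
    ‖((ratPlusSymbol f ((a : ℚ) / (2 : ℚ) ^ k) : ℚ) : ℚ_[2])‖ ≤ 2 := by
  have hreal : ∀ n, (cuspCoeff f n).im = 0 := cuspCoeff_im_eq_zero_of_coeffField_eq_bot hQ
  have h0 : (((ap - 3 : ℤ) : ℂ)) * modularSymbol f 0 ∈ periodLattice f := by
    have h := sub_mul_modularSymbol_zero_mem_periodLattice hf0 Nat.prime_two hN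
    rw [hap] at h
    convert h using 2
    push_cast
    ring
  have hodd : ¬ (2 : ℤ) ∣ ap - 3 := by
    intro h
    have h3 : (2 : ℤ) ∣ 3 := by
      have := dvd_sub hpa h
      rwa [sub_sub_cancel] at this
    omega
  have hx : Nat.Coprime ((a : ℚ) / (2 : ℚ) ^ k).den N := by
    have h := coprime_den_div_prime_pow (p := 2) hN a k
    exact_mod_cast h
  exact norm_ratPlusSymbol_two_le_two f hreal hodd h0 hx

/-- **`θ_n ∈ ℤ₂[T]` at a good supersingular `2`**: by the `Δ`-doubling every coefficient of the
Mazur–Tate element is `2·[5^s/2^{n+2}]⁺_f`, of `2`-adic norm `≤ ‖2‖₂ · 2 = 1`; hence the image of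
`θ_n` in `ℚ₂[T]` lifts to `ℤ₂[T]` (the `p = 2` case of Sprung 2017, Cor. 4.10, with the shift
`N = n + 2` of §1.1). [cite: Sprung2017, §1.1 and Cor. 4.10] -/
theorem exists_map_eq_map_mazurTateElement_two (hf0 : IsNewform0 f) (hQ : coeffField f = ⊥)
    (hN : ¬ 2 ∣ N) {ap : ℤ} (hap : cuspCoeff f 2 = ap) (hpa : (2 : ℤ) ∣ ap) (n : ℕ) :
    ∃ Θ : ℤ_[2][X], Θ.map (algebraMap ℤ_[2] ℚ_[2]) =
      (mazurTateElement f 2 n).map (algebraMap ℚ ℚ_[2]) := by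
  classical
  rw [← Polynomial.mem_lifts, mazurTateElement_two_eq, Polynomial.map_sum]
  refine Subsemiring.sum_mem _ fun s _ ↦ ?_
  rw [Polynomial.map_mul, Polynomial.map_pow, Polynomial.map_add, Polynomial.map_X,
    Polynomial.map_one, Polynomial.map_C]
  refine Subsemiring.mul_mem _ ?_ (Subsemiring.pow_mem _
    (Subsemiring.add_mem _ (X_mem_lifts _) (Subsemiring.one_mem _)) _)
  set q : ℚ := ratPlusSymbol f
    ((((cyclotomicGenerator 2 : ZMod (2 ^ (n + 2))) ^ s.val).val : ℚ) / (2 : ℚ) ^ (n + 2)) with hq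
  have hqn : ‖(q : ℚ_[2])‖ ≤ 2 :=
    norm_ratPlusSymbol_div_two_pow_le_two_of_even hf0 hQ hN hap hpa _ _
  have h2 : ‖(2 : ℚ_[2])‖ = (2 : ℝ)⁻¹ := by
    have h := Padic.norm_p (p := 2)
    simpa using h
  have hnorm : ‖((2 * q : ℚ) : ℚ_[2])‖ ≤ 1 := by
    push_cast
    rw [norm_mul, h2]
    calc (2 : ℝ)⁻¹ * ‖(q : ℚ_[2])‖ ≤ (2 : ℝ)⁻¹ * 2 := by gcongr
      _ = 1 := by norm_num
  have heq : algebraMap ℚ ℚ_[2] (2 * q) = algebraMap ℤ_[2] ℚ_[2] ⟨((2 * q : ℚ) : ℚ_[2]), hnorm⟩ := by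
    rw [eq_ratCast]
    rfl
  rw [heq]
  exact C_mem_lifts _ _

/-- **Sprung's pair exists at `2`, integrally**: for `f` rational of odd level `N` with
`a₂(f) = a₂` EVEN, there are `L♯, L♭ ∈ Λ = ℤ₂⟦T⟧` with `θ_m + u_m L♯ + v_m L♭ ∈ ω_m Λ` for every
`m ≥ 0` (`θ_m` of level `2^{m+2}`; `u_m, v_m` the recursion polynomials `sharpPoly`, `flatPoly`).
The `p`-uniform construction `exists_integral_isSprungPair_of_lifts` (approximants `Y_n`,
Wronskians, `(p,T)`-adic convergence: `u_n, v_n ∈ (2,T)^{⌊n/2⌋}` since `2 ∣ a₂` — Sprung's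
`𝔐 = 0`) fed with the lifts of `exists_map_eq_map_mazurTateElement_two` and the three-term
relation `cyclotomicOmega_dvd_threeTerm` (any `p`). [cite: Sprung2017, §1.1, Thm. 1.12, Cor. 4.4 and Cor. 4.10] -/
theorem exists_integral_isSprungPair_two (hf0 : IsNewform0 f) (hQ : coeffField f = ⊥)
    (hN : ¬ 2 ∣ N) {ap : ℤ} (hap : cuspCoeff f 2 = ap) (hpa : (2 : ℤ) ∣ ap) :
    ∃ Ls Lf : IwasawaAlgebra 2, ∀ m : ℕ, ∃ Q : IwasawaAlgebra 2,
      ((mazurTateElement f 2 m).map (algebraMap ℚ ℚ_[2]) : PowerSeries ℚ_[2]) +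
          iwasawaToPowerSeries 2
            (toIwasawa 2 (sharpPoly ap 2 m) * Ls + toIwasawa 2 (flatPoly ap 2 m) * Lf) =
        iwasawaToPowerSeries 2
          (((cyclotomicOmega 2 m).map (Int.castRingHom ℤ_[2]) : PowerSeries ℤ_[2]) * Q) :=
  exists_integral_isSprungPair_of_lifts hpa
    (exists_lifts_threeTerm_of_lifts hf0 hQ hN hap
      fun n ↦ exists_map_eq_map_mazurTateElement_two hf0 hQ hN hap hpa n)

end Integral

/-! ## §3. T2-pair: `IsSprungPair f 2 (a₂(E)) L♯ L♭` for every good supersingular `2` -/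

section Pair

variable {W : WeierstrassCurve ℚ} [W.IsElliptic] [W.IsGloballyMinimal] {N : ℕ} [NeZero N]
  {f : CuspForm (Gamma0 N) 2}

/-- **T2-pair (o1 lens-1 R-L1-G6-A): Sprung's ♯/♭ pair EXISTS at `p = 2`** in the tree's
Mazur–Tate characterisation — for `f` the newform of `E = W` (`IsNewformOf W f`), `E` with good
reduction at `2` and `2 ∣ a₂(E)` (good SUPERSINGULAR reduction at `2`, `a₂ ∈ {0, ±2}`), there are
`L♯, L♭ ∈ Λ = ℤ₂⟦T⟧` with `θ_n ≡ −(u_n L♯ + v_n L♭) (mod ω_n)` for all `n`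
(`IsSprungPair f 2 (a₂(E)) L♯ L♭`, in fact integrally: exponent `0` in `IsCongrModOmega`). This is
the statement of `thm112_exists_isSprungPair` with its binder `p ≠ 2` REMOVED — Sprung 2017 covers
`p = 2` with the shift `N = n + 2` (§1.1), which is the tree's `mazurTateElement f 2 n`; the only
`2`-specific input is the `Δ`-doubling (`mazurTateElement_two_eq`). Assembly as in
`thm112_exists_isSprungPair_holds`: `2 ∤ N` (`not_dvd_level_of_isNewformOf`), `a₂(f) = a₂(E)`
(`cuspCoeff_eq_frobeniusTrace_of_isNewformOf_holds`). [cite: Sprung2017, §1.1, Thm. 1.12, Cor. 4.4, Cor. 4.5 and Cor. 4.10] -/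
theorem exists_isSprungPair_two (hf : IsNewformOf W f) (hgood : W.HasGoodReductionAtPrime 2)
    (hap : (2 : ℤ) ∣ W.frobeniusTrace 2) :
    ∃ Lsharp Lflat : IwasawaAlgebra 2, IsSprungPair f 2 (W.frobeniusTrace 2) Lsharp Lflat := by
  have hf0 : IsNewform0 f := hf.1
  have hQ : coeffField f = ⊥ := hf.coeffField_eq_bot
  have hpN : ¬ 2 ∣ N := not_dvd_level_of_isNewformOf hf hgood
  have hap' : cuspCoeff f 2 = ((W.frobeniusTrace 2 : ℤ) : ℂ) :=
    cuspCoeff_eq_frobeniusTrace_of_isNewformOf_holds hf hgood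
  obtain ⟨Ls, Lf, h⟩ := exists_integral_isSprungPair_two hf0 hQ hpN hap' hap
  refine ⟨Ls, Lf, fun m ↦ ?_⟩
  obtain ⟨Q, hQm⟩ := h m
  refine ⟨0, Q, ?_⟩
  rw [pow_zero, map_one, one_mul, Polynomial.map_neg, Polynomial.map_one, Polynomial.coe_neg,
    Polynomial.coe_one, neg_one_mul, map_neg, sub_neg_eq_add, hQm]

/-- **Sprung's pair at EVERY good supersingular prime** (prime-uniform form): for `f` the newform of
`E = W`, `E` with good reduction at `p` and `p ∣ a_p(E)`, there are `L♯, L♭ ∈ ℤ_p⟦T⟧` with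
`IsSprungPair f p (a_p(E)) L♯ L♭` — odd `p` by `thm112_exists_isSprungPair_holds`, `p = 2` by
`exists_isSprungPair_two`. [cite: Sprung2017, §1.1, Thm. 1.12, Cor. 4.4 and Cor. 4.10] -/
theorem exists_isSprungPair_anyPrime {p : ℕ} [Fact p.Prime] (hf : IsNewformOf W f)
    (hgood : W.HasGoodReductionAtPrime p) (hap : (p : ℤ) ∣ W.frobeniusTrace p) :
    ∃ Lsharp Lflat : IwasawaAlgebra p, IsSprungPair f p (W.frobeniusTrace p) Lsharp Lflat := by
  by_cases hp2 : p = 2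
  · subst hp2
    exact exists_isSprungPair_two hf hgood hap
  · exact thm112_exists_isSprungPair_holds hp2 hf hgood hap

end Pair

end Literature.NumberTheory.EllipticCurves.Sprung2017

end
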